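import Summits.ABC.IUTFork.Joshi.TestGenuinePinsVacuityNeRat
import Mathlib.NumberTheory.RamificationInertia.Galois
import HarnessLib

/-!
# Branch E TEST — corollaries of the kernel residual theorem of row Y-26 with purely GLOBAL hypotheses

Proof-only sequel (abc-iut cell, D-0079 R-J «Joshi Y-discharge census», row Y-26 residual class; seat abc-iut-E-t43, gen 5; 0 definitions,
no `Prop` fact, FACT rows used: none) to `Joshi/TestGenuinePinsVacuityNeRat.lean` (this seat: for every number field `F ≠ ℚ`, the
genuine-carrier pins are KERNEL-EMPTY unless some ramified place is a `(2,1)`-place over `3` of `ℚ_3(ζ_3)`-type or a `(2,1)`-place over `2`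
of `ℚ_2(√3)`-type).  Here the two local exclusions are discharged from GLOBAL data — each result a `¬ Cor312Vol.PinnedRegions`
(/ `¬ PinnedRegions3`) theorem at abc-iut-c312-7's `settingPrVolSharp` over `LatticeSituation.ofShells (logShellsDH X (analyticLogv F)) …`,
analytic logarithms, EVERY `X : PilotData F`, `ρ`, `qK`, column data, `Ψ`, ideles, column:

* **`…_of_two_le_ramificationIdx`** (§1) — the PLACE-BY-PLACE UNION of all feeds: ANY single ramified place `u` (`e ≥ 2`, any `p`) that is
  not of the two residual types suffices (e.g. `ℚ(√3)` through its place over `3`, although its dyadic place is of `ℚ_2(√3)`-type);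
* `…_of_one_lt_finrank_of_forall_ne_two_one` — `F ≠ ℚ` with NO `(e, f) = (2, 1)`-place over `2` or `3` at all;
* (the class «`F ≠ ℚ`, `2 ∤ d_F`, `3 ∤ d_F`» is abc-iut-E-t41's `not_pinnedRegions_settingPrVolSharp_of_not_dvd_discr` in
  `Joshi/TestGenuinePinsDividingLine.lean`, p489924 — landed concurrently with the parent file; not restated here);
* `…_of_isGalois_of_odd_finrank` — `F/ℚ` GALOIS of ODD degree `> 1` (`e·f ∣ [F : ℚ]`, Neukirch I (9.6) via Mathlib's
  `Ideal.card_stabilizer_eq`, so no local degree is `2`): every cyclic cubic field, `ℚ(ζ_7)⁺`, `ℚ(ζ_9)⁺`, …;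
* `…_of_dvd_discr_of_five_le` — ANY `F` whose discriminant has a prime factor `p ≥ 5` (Dedekind ⇒ a place over `p` with `e ≥ 2` ⇒
  abc-iut-E-t44's p446474), i.e. every `F` with `d_F ≠ ± 2^a 3^b`.

WHAT STAYS ON PAPER (unchanged): «no `F ≠ ℚ` has all its ramification of the two residual types» (`rd(F) ≤ 2√3` + small-degree tables).
HONEST SCOPE: OUR interface, OUR sharp real container, Dupuy–Hilado's reading of (Ind2); nothing here bears on print's (xi-e)/(xi-f);
locates / conditionally verifies; no abc claim. [claim: Mochizuki2012, status: disputed] [cite: DupuyHilado2025, §4.9]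
[cite: NeukirchANT1999, Ch. I Prop. (9.6), Ch. III Thm. (2.12)]
-/

noncomputable section

open Set Function NumberField IsDedekindDomain Metric
open scoped Pointwise

namespace Summit.ABC.IUTFork.Joshi

open Thm311 Thm311.Real Cor312 Cor312Vol Literature.IUT.LogThetaLattice Literature.IUT.LogVolume
  Literature.IUT.HodgeTheaters Literature.NumberTheory.NumberFields
open Literature.NumberTheory.GaloisRepresentations.Ultrametric

/-! ## 0. Classical helper -/

namespace GenuinePinsResidual

/-- **`F/ℚ` Galois ⇒ `e(w|p)·f(w|p) ∣ [F : ℚ]`** (the decomposition group has order `e·f`; Mathlib `Ideal.card_stabilizer_eq`; the tree's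
`localDeg_dvd_finrank_of_isGalois` re-derived here to keep the import light). [cite: NeukirchANT1999, Ch. I Prop. (9.6)] -/
theorem ramificationIdx_mul_inertiaDeg_dvd_finrank {F : Type} [Field F] [NumberField F] [IsGalois ℚ F]
    (w : HeightOneSpectrum (𝓞 F)) : w.asIdeal.ramificationIdx ℤ * w.asIdeal.inertiaDeg ℤ ∣ Module.finrank ℚ F := by
  haveI : w.asIdeal.IsMaximal := w.isMaximal
  haveI : IsGaloisGroup (F ≃ₐ[ℚ] F) ℤ (𝓞 F) := IsGaloisGroup.of_isFractionRing _ _ _ ℚ F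
  have h := Ideal.card_stabilizer_eq (G := F ≃ₐ[ℚ] F) (w.asIdeal.under ℤ) w.asIdeal
  rw [Ideal.ramificationIdxIn_eq_ramificationIdx (w.asIdeal.under ℤ) w.asIdeal (F ≃ₐ[ℚ] F),
    Ideal.inertiaDegIn_eq_inertiaDeg (w.asIdeal.under ℤ) w.asIdeal (F ≃ₐ[ℚ] F)] at h
  rw [← h, ← IsGalois.card_aut_eq_finrank]
  exact Subgroup.card_subgroup_dvd_card _


end GenuinePinsResidual

open GenuinePinsResidual

variable {F : Type} [Field F] [NumberField F] (X : PilotData F)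
  (M : Type) [Field M] [NumberField M]
  (archPk : ∀ (j : (thetaIndex X).Label) (vQ : (thetaIndex X).VQ), Set ((logShellsDH X (analyticLogv F)).Packet j vQ))
  (archSub : ∀ (j : (thetaIndex X).Label) (v : (thetaIndex X).V),
    Set ((logShellsDH X (analyticLogv F)).Packet j ((thetaIndex X).over v)))
  (Ψ : ℤ → ∀ v : (thetaIndex X).V, v ∈ (thetaIndex X).Vbad → Set ((logShellsDH X (analyticLogv F)).StarPacket v))
  (act : ℤ → ∀ v : (thetaIndex X).V, v ∈ (thetaIndex X).Vbad →
    (logShellsDH X (analyticLogv F)).StarPacket v → Module.End ℚ ((logShellsDH X (analyticLogv F)).StarPacket v))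
  (Mmod : ℤ → ∀ j : (thetaIndex X).LabelStar, Set ((logShellsDH X (analyticLogv F)).GlobalPacket j.1))
  (region : ℤ → ∀ j : (thetaIndex X).LabelStar, FinDivisor M → ∀ vQ : (thetaIndex X).VQ,
    Set ((logShellsDH X (analyticLogv F)).Packet j.1 vQ))
  (frobAdm : ℤ → ℤ → ∀ (j : (thetaIndex X).Label) (vQ : (thetaIndex X).VQ),
    Set ((logShellsDH X (analyticLogv F)).Packet j vQ) → Prop)
  (frobLogvol : ℤ → ℤ → ∀ (j : (thetaIndex X).Label) (vQ : (thetaIndex X).VQ),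
    Set ((logShellsDH X (analyticLogv F)).Packet j vQ) → ℝ)
  (frobΨ : ℤ → ℤ → ∀ v : (thetaIndex X).V, v ∈ (thetaIndex X).Vbad → Set ((logShellsDH X (analyticLogv F)).StarPacket v))
  (frobMmod : ℤ → ℤ → ∀ j : (thetaIndex X).LabelStar, Set ((logShellsDH X (analyticLogv F)).GlobalPacket j.1))
  (unitImage : ℤ → ℤ → ℕ → ∀ (j : (thetaIndex X).Label) (vQ : (thetaIndex X).VQ),
    Set ((logShellsDH X (analyticLogv F)).Packet j vQ))
  (ballImage : ℤ → ℤ → ∀ (j : (thetaIndex X).Label) (vQ : (thetaIndex X).VQ),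
    Set ((logShellsDH X (analyticLogv F)).Packet j vQ))
  (thetaDiv : ℤ → ℤ → LgpDivisor M (thetaIndex X).lstar)
  (n : ℤ) {HT : Type} {LogLink : HT → HT → Type} {IsFull : ∀ {s t : HT}, LogLink s t → Prop}
  (lat : LGPGaussianLogThetaLattice LogLink IsFull)
  {Frd : Type} {IsoF : Frd → Frd → Type} {Ob : Frd → Type} {realify : Frd → Frd} {Strip : Type}
  {IsoS : Strip → Strip → Type} {Mv : ∀ v : (thetaIndex X).V, v ∈ (thetaIndex X).Vbad → Type}
  [∀ v h, Monoid (Mv v h)]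
  (sig : GlobalLGPFrobenioidSignature (thetaIndex X).lstar (thetaIndex X).V (· ∈ (thetaIndex X).Vbad)
    Frd IsoF Ob realify Strip IsoS Mv)
  (split : SplittingMonoids Mv) {ObΔ : Type} {N : ∀ v : (thetaIndex X).V, v ∈ (thetaIndex X).Vbad → Type}
  [∀ v h, Monoid (N v h)] (qData : QPilotData ObΔ N)
  (t : ∀ (pp : Nat.Primes) (_ : Fin X.lstar) (x : (thetaIndex X).Fibre (.inr pp)),
    haveI : Fact (pp : ℕ).Prime := ⟨pp.2⟩; kOf X pp.1 x)
  (tq : ∀ (pp : Nat.Primes) (x : (thetaIndex X).Fibre (.inr pp)), haveI : Fact (pp : ℕ).Prime := ⟨pp.2⟩; kOf X pp.1 x)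
  (ρ : (∀ v : (thetaIndex X).V, v ∈ (thetaIndex X).Vbad → Set ((logShellsDH X (analyticLogv F)).StarPacket v)) →
    ∀ (j : (thetaIndex X).Label) (vQ : (thetaIndex X).VQ), Set ((logShellsDH X (analyticLogv F)).Packet j vQ))
  (qK : ∀ v : (thetaIndex X).V, v ∈ (thetaIndex X).Vbad → Set ((logShellsDH X (analyticLogv F)).StarPacket v))
  (htq0 : ∀ pp x, tq pp x ≠ 0)
  (htq1 : ∀ (pp : Nat.Primes) (x : (thetaIndex X).Fibre (.inr pp)),
    haveI : Fact (pp : ℕ).Prime := ⟨pp.2⟩; placeOf X pp.1 x ∉ X.S → ‖tq pp x‖ = 1)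

/-! ## 1. ONE ramified place off the two residual types suffices -/

/-- **ANY SINGLE RAMIFIED PLACE `u` (`e(u|p) ≥ 2`, any `p`, bad places allowed) THAT IS NOT OF THE TWO RESIDUAL TYPES** — not a
`(2,1)`-place over `3` with `ζ_3` in its completion, not a `(2,1)`-place over `2` with `log₂(𝒪_u^×) = 2𝒪_u` — **makes `PinnedRegions` FAIL at
`settingPrVolSharp`** for the analytic logarithms (every `X : PilotData F`, `ρ`, `qK`, column data, `Ψ`, ideles, column).  This is the
place-by-place union of the feeds p446474 (`p ≥ 5`), p461298 (`p = 3`; `p = 2` off `(2,1)`) and `…_of_wild_quadratic_dyadic_anyPrime`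
(`p = 2` at `(2,1)`); e.g. `F = ℚ(√3)` through its place over `3` (its dyadic place IS of `ℚ_2(√3)`-type).  «`u` over `3`» is encoded by the
binder `hv : 3 ∈ u`. [cite: DupuyHilado2025, §4.9] [cite: NeukirchANT1999, Ch. II Prop. (5.5), (5.7)] [claim: Mochizuki2012, status: disputed] -/
theorem not_pinnedRegions_settingPrVolSharp_of_two_le_ramificationIdx (u : HeightOneSpectrum (𝓞 F))
    (he2 : 2 ≤ u.asIdeal.ramificationIdx ℤ)
    (h3 : ∀ hv : ((3 : ℕ) : 𝓞 F) ∈ u.asIdeal, u.asIdeal.ramificationIdx ℤ = 2 → u.asIdeal.inertiaDeg ℤ = 1 →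
      haveI : Fact (Nat.Prime 3) := ⟨Nat.prime_three⟩
      torsionPExp 3 (RescaledCompletion F 3 u hv) = 0)
    (h2 : ∀ hv : ((2 : ℕ) : 𝓞 F) ∈ u.asIdeal, u.asIdeal.ramificationIdx ℤ = 2 → u.asIdeal.inertiaDeg ℤ = 1 →
      haveI : Fact (Nat.Prime 2) := ⟨Nat.prime_two⟩
      logUnits (RescaledCompletion F 2 u hv) ≠ closedBall (0 : RescaledCompletion F 2 u hv) ‖(2 : RescaledCompletion F 2 u hv)‖) :
    ¬ Cor312Vol.PinnedRegions
      (LatticeSituation.ofShells (logShellsDH X (analyticLogv F)) M archPk archSub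
        (summandPiecesPr X (logvAnalytic_analyticLogv (F := F))).Adm
        (summandPiecesPr X (logvAnalytic_analyticLogv (F := F))).logvol Ψ act Mmod region frobAdm frobLogvol frobΨ frobMmod
        unitImage ballImage thetaDiv)
      (settingPrVolSharp X (logvAnalytic_analyticLogv (F := F)) M archPk archSub Ψ act Mmod region n lat sig split qData tq t
        htq0 htq1) ρ qK := by
  obtain ⟨p, hp, hres⟩ : ∃ p : ℕ, p.Prime ∧ residueChar F u = p := ⟨_, residueChar_prime F u, rfl⟩
  haveI : Fact p.Prime := ⟨hp⟩
  have hu₀ : (thetaIndex X).over (.inr u) = .inr ⟨p, hp⟩ := by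
    rw [over_inr_eq]; exact congrArg Sum.inr (Subtype.ext hres)
  have hu : ((p : ℕ) : 𝓞 F) ∈ u.asIdeal := natCast_mem_placeOf X (⟨p, hp⟩ : Nat.Primes) ⟨.inr u, hu₀⟩
  by_cases hp5 : 5 ≤ p
  · exact not_pinnedRegions_settingPrVolSharp_of_ramified_five_le_anyPrime X M archPk archSub Ψ act Mmod region frobAdm frobLogvol frobΨ
          frobMmod unitImage ballImage thetaDiv n lat sig split qData t tq ρ qK htq0 htq1 ⟨p, hp⟩ hp5 u hu₀ he2
  · have hp23 : p = 2 ∨ p = 3 := by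
      have h2 := hp.two_le
      have h4 : p ≠ 4 := fun h => by rw [h] at hp; exact absurd hp (by decide)
      omega
    rcases hp23 with rfl | rfl
    · -- a ramified place over `2`
      by_cases hef : u.asIdeal.ramificationIdx ℤ = 2 ∧ u.asIdeal.inertiaDeg ℤ = 1
      · exact not_pinnedRegions_settingPrVolSharp_of_wild_quadratic_dyadic_anyPrime X M archPk archSub Ψ act Mmod region frobAdm frobLogvol frobΨ
          frobMmod unitImage ballImage thetaDiv n lat sig split qData t tq ρ qK htq0 htq1 u hu₀ hu hef.1 hef.2 (h2 hu hef.1 hef.2)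
      · exact not_pinnedRegions_settingPrVolSharp_of_dyadic_complete_anyPrime X M archPk archSub Ψ act Mmod region frobAdm frobLogvol frobΨ
          frobMmod unitImage ballImage thetaDiv n lat sig split qData t tq ρ qK htq0 htq1 u hu₀ he2 hef
    · -- a ramified place over `3`
      by_cases hef : u.asIdeal.ramificationIdx ℤ = 2 ∧ u.asIdeal.inertiaDeg ℤ = 1
      · exact not_pinnedRegions_settingPrVolSharp_of_torsionPExp_eq_zero_anyPrime X M archPk archSub Ψ act Mmod region frobAdm frobLogvol frobΨ
          frobMmod unitImage ballImage thetaDiv n lat sig split qData t tq ρ qK htq0 htq1 ⟨3, hp⟩ u hu₀ hu he2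
          (h3 hu hef.1 hef.2)
      · exact not_pinnedRegions_settingPrVolSharp_of_three_anyPrime X M archPk archSub Ψ act Mmod region frobAdm frobLogvol frobΨ
          frobMmod unitImage ballImage thetaDiv n lat sig split qData t tq ρ qK htq0 htq1 u hu₀ he2 hef

/-- The same for `PinnedRegions3`. [claim: Mochizuki2012, status: disputed] -/
theorem not_pinnedRegions3_settingPrVolSharp_of_two_le_ramificationIdx (u : HeightOneSpectrum (𝓞 F))
    (he2 : 2 ≤ u.asIdeal.ramificationIdx ℤ)
    (h3 : ∀ hv : ((3 : ℕ) : 𝓞 F) ∈ u.asIdeal, u.asIdeal.ramificationIdx ℤ = 2 → u.asIdeal.inertiaDeg ℤ = 1 →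
      haveI : Fact (Nat.Prime 3) := ⟨Nat.prime_three⟩
      torsionPExp 3 (RescaledCompletion F 3 u hv) = 0)
    (h2 : ∀ hv : ((2 : ℕ) : 𝓞 F) ∈ u.asIdeal, u.asIdeal.ramificationIdx ℤ = 2 → u.asIdeal.inertiaDeg ℤ = 1 →
      haveI : Fact (Nat.Prime 2) := ⟨Nat.prime_two⟩
      logUnits (RescaledCompletion F 2 u hv) ≠ closedBall (0 : RescaledCompletion F 2 u hv) ‖(2 : RescaledCompletion F 2 u hv)‖) :
    ¬ Cor312Vol.PinnedRegions3
      (LatticeSituation.ofShells (logShellsDH X (analyticLogv F)) M archPk archSub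
        (summandPiecesPr X (logvAnalytic_analyticLogv (F := F))).Adm
        (summandPiecesPr X (logvAnalytic_analyticLogv (F := F))).logvol Ψ act Mmod region frobAdm frobLogvol frobΨ frobMmod
        unitImage ballImage thetaDiv)
      (settingPrVolSharp X (logvAnalytic_analyticLogv (F := F)) M archPk archSub Ψ act Mmod region n lat sig split qData tq t
        htq0 htq1) ρ qK :=
  fun h => not_pinnedRegions_settingPrVolSharp_of_two_le_ramificationIdx X M archPk archSub Ψ act Mmod region frobAdm frobLogvol frobΨ
          frobMmod unitImage ballImage thetaDiv n lat sig split qData t tq ρ qK htq0 htq1 u he2 h3 h2 h.1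

/-! ## 2. Corollaries with purely global hypotheses -/

/-- **`F ≠ ℚ` WITH NO `(e, f) = (2, 1)`-PLACE OVER `2` OR `3`** (e.g. `2` and `3` unramified in `F`; or every place over `2`, `3` of
local degree `≠ 2`): `PinnedRegions` FAILS at `settingPrVolSharp` for the analytic logarithms. [cite: DupuyHilado2025, §4.9]
[cite: NeukirchANT1999, Ch. III Thm. (2.12)] [claim: Mochizuki2012, status: disputed] -/
theorem not_pinnedRegions_settingPrVolSharp_of_one_lt_finrank_of_forall_ne_two_one (hF : 1 < Module.finrank ℚ F)
    (h : ∀ v : HeightOneSpectrum (𝓞 F), residueChar F v = 2 ∨ residueChar F v = 3 →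
      ¬ (v.asIdeal.ramificationIdx ℤ = 2 ∧ v.asIdeal.inertiaDeg ℤ = 1)) :
    ¬ Cor312Vol.PinnedRegions
      (LatticeSituation.ofShells (logShellsDH X (analyticLogv F)) M archPk archSub
        (summandPiecesPr X (logvAnalytic_analyticLogv (F := F))).Adm
        (summandPiecesPr X (logvAnalytic_analyticLogv (F := F))).logvol Ψ act Mmod region frobAdm frobLogvol frobΨ frobMmod
        unitImage ballImage thetaDiv)
      (settingPrVolSharp X (logvAnalytic_analyticLogv (F := F)) M archPk archSub Ψ act Mmod region n lat sig split qData tq t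
        htq0 htq1) ρ qK :=
  not_pinnedRegions_settingPrVolSharp_of_one_lt_finrank X M archPk archSub Ψ act Mmod region frobAdm frobLogvol frobΨ
          frobMmod unitImage ballImage thetaDiv n lat sig split qData t tq ρ qK htq0 htq1 hF
    (fun v hv he hf => absurd ⟨he, hf⟩ (h v (Or.inr
      ((mem_placesOver_iff_residueChar v).mp ((mem_placesOver_iff v).mpr
        (by haveI : Fact (Nat.Prime 3) := ⟨Nat.prime_three⟩; exact liesOver_span_of_natCast_mem F 3 v hv))))))
    (fun v hv he hf => absurd ⟨he, hf⟩ (h v (Or.inl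
      ((mem_placesOver_iff_residueChar v).mp ((mem_placesOver_iff v).mpr
        (by haveI : Fact (Nat.Prime 2) := ⟨Nat.prime_two⟩; exact liesOver_span_of_natCast_mem F 2 v hv))))))

/-- The same for `PinnedRegions3`. [claim: Mochizuki2012, status: disputed] -/
theorem not_pinnedRegions3_settingPrVolSharp_of_one_lt_finrank_of_forall_ne_two_one (hF : 1 < Module.finrank ℚ F)
    (h : ∀ v : HeightOneSpectrum (𝓞 F), residueChar F v = 2 ∨ residueChar F v = 3 →
      ¬ (v.asIdeal.ramificationIdx ℤ = 2 ∧ v.asIdeal.inertiaDeg ℤ = 1)) :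
    ¬ Cor312Vol.PinnedRegions3
      (LatticeSituation.ofShells (logShellsDH X (analyticLogv F)) M archPk archSub
        (summandPiecesPr X (logvAnalytic_analyticLogv (F := F))).Adm
        (summandPiecesPr X (logvAnalytic_analyticLogv (F := F))).logvol Ψ act Mmod region frobAdm frobLogvol frobΨ frobMmod
        unitImage ballImage thetaDiv)
      (settingPrVolSharp X (logvAnalytic_analyticLogv (F := F)) M archPk archSub Ψ act Mmod region n lat sig split qData tq t
        htq0 htq1) ρ qK :=
  fun h' => not_pinnedRegions_settingPrVolSharp_of_one_lt_finrank_of_forall_ne_two_one X M archPk archSub Ψ act Mmod region frobAdm frobLogvol frobΨ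
          frobMmod unitImage ballImage thetaDiv n lat sig split qData t tq ρ qK htq0 htq1 hF h h'.1

/-- **`F/ℚ` GALOIS OF ODD DEGREE `> 1`**: every local degree `e·f` divides `[F : ℚ]`, so no place has `(e, f) = (2, 1)`, and `PinnedRegions`
FAILS at `settingPrVolSharp` for the analytic logarithms (e.g. every cyclic cubic field, `ℚ(ζ_7)⁺`, `ℚ(ζ_9)⁺`).
[cite: DupuyHilado2025, §4.9] [cite: NeukirchANT1999, Ch. I Prop. (9.6), Ch. III Thm. (2.12)] [claim: Mochizuki2012, status: disputed] -/
theorem not_pinnedRegions_settingPrVolSharp_of_isGalois_of_odd_finrank [IsGalois ℚ F] (hF : 1 < Module.finrank ℚ F)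
    (hodd : Odd (Module.finrank ℚ F)) :
    ¬ Cor312Vol.PinnedRegions
      (LatticeSituation.ofShells (logShellsDH X (analyticLogv F)) M archPk archSub
        (summandPiecesPr X (logvAnalytic_analyticLogv (F := F))).Adm
        (summandPiecesPr X (logvAnalytic_analyticLogv (F := F))).logvol Ψ act Mmod region frobAdm frobLogvol frobΨ frobMmod
        unitImage ballImage thetaDiv)
      (settingPrVolSharp X (logvAnalytic_analyticLogv (F := F)) M archPk archSub Ψ act Mmod region n lat sig split qData tq t
        htq0 htq1) ρ qK :=
  not_pinnedRegions_settingPrVolSharp_of_one_lt_finrank_of_forall_ne_two_one X M archPk archSub Ψ act Mmod region frobAdm frobLogvol frobΨ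
          frobMmod unitImage ballImage thetaDiv n lat sig split qData t tq ρ qK htq0 htq1 hF fun v _ hef => by
    have hdvd := ramificationIdx_mul_inertiaDeg_dvd_finrank (F := F) v
    rw [hef.1, hef.2, mul_one] at hdvd
    exact (Nat.not_even_iff_odd.mpr hodd) (even_iff_two_dvd.mpr hdvd)

/-- The same for `PinnedRegions3`. [claim: Mochizuki2012, status: disputed] -/
theorem not_pinnedRegions3_settingPrVolSharp_of_isGalois_of_odd_finrank [IsGalois ℚ F] (hF : 1 < Module.finrank ℚ F)
    (hodd : Odd (Module.finrank ℚ F)) :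
    ¬ Cor312Vol.PinnedRegions3
      (LatticeSituation.ofShells (logShellsDH X (analyticLogv F)) M archPk archSub
        (summandPiecesPr X (logvAnalytic_analyticLogv (F := F))).Adm
        (summandPiecesPr X (logvAnalytic_analyticLogv (F := F))).logvol Ψ act Mmod region frobAdm frobLogvol frobΨ frobMmod
        unitImage ballImage thetaDiv)
      (settingPrVolSharp X (logvAnalytic_analyticLogv (F := F)) M archPk archSub Ψ act Mmod region n lat sig split qData tq t
        htq0 htq1) ρ qK :=
  fun h => not_pinnedRegions_settingPrVolSharp_of_isGalois_of_odd_finrank X M archPk archSub Ψ act Mmod region frobAdm frobLogvol frobΨ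
          frobMmod unitImage ballImage thetaDiv n lat sig split qData t tq ρ qK htq0 htq1 hF hodd h.1

/-- **A PRIME `p ≥ 5` DIVIDING `d_F`** (any `F`; e.g. every `F ≠ ℚ` whose discriminant is not `± 2^a 3^b`): `PinnedRegions` FAILS at
`settingPrVolSharp` for the analytic logarithms — Dedekind gives a place over `p` with `e ≥ 2`, then abc-iut-E-t44's p446474.
[cite: DupuyHilado2025, §4.9] [cite: NeukirchANT1999, Ch. III Thm. (2.12)] [claim: Mochizuki2012, status: disputed] -/
theorem not_pinnedRegions_settingPrVolSharp_of_dvd_discr_of_five_le (p : ℕ) (hp : p.Prime) (hp5 : 5 ≤ p)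
    (hpd : (p : ℤ) ∣ NumberField.discr F) :
    ¬ Cor312Vol.PinnedRegions
      (LatticeSituation.ofShells (logShellsDH X (analyticLogv F)) M archPk archSub
        (summandPiecesPr X (logvAnalytic_analyticLogv (F := F))).Adm
        (summandPiecesPr X (logvAnalytic_analyticLogv (F := F))).logvol Ψ act Mmod region frobAdm frobLogvol frobΨ frobMmod
        unitImage ballImage thetaDiv)
      (settingPrVolSharp X (logvAnalytic_analyticLogv (F := F)) M archPk archSub Ψ act Mmod region n lat sig split qData tq t
        htq0 htq1) ρ qK := by
  obtain ⟨u, hres, he2⟩ := Cor22.exists_ramified_place_of_dvd_discr F hp hpd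
  have hu₀ : (thetaIndex X).over (.inr u) = .inr ⟨p, hp⟩ := by
    rw [over_inr_eq]; exact congrArg Sum.inr (Subtype.ext hres)
  exact not_pinnedRegions_settingPrVolSharp_of_ramified_five_le_anyPrime X M archPk archSub Ψ act Mmod region frobAdm frobLogvol frobΨ
          frobMmod unitImage ballImage thetaDiv n lat sig split qData t tq ρ qK htq0 htq1 ⟨p, hp⟩ hp5 u hu₀ he2

/-- The same for `PinnedRegions3`. [claim: Mochizuki2012, status: disputed] -/
theorem not_pinnedRegions3_settingPrVolSharp_of_dvd_discr_of_five_le (p : ℕ) (hp : p.Prime) (hp5 : 5 ≤ p)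
    (hpd : (p : ℤ) ∣ NumberField.discr F) :
    ¬ Cor312Vol.PinnedRegions3
      (LatticeSituation.ofShells (logShellsDH X (analyticLogv F)) M archPk archSub
        (summandPiecesPr X (logvAnalytic_analyticLogv (F := F))).Adm
        (summandPiecesPr X (logvAnalytic_analyticLogv (F := F))).logvol Ψ act Mmod region frobAdm frobLogvol frobΨ frobMmod
        unitImage ballImage thetaDiv)
      (settingPrVolSharp X (logvAnalytic_analyticLogv (F := F)) M archPk archSub Ψ act Mmod region n lat sig split qData tq t
        htq0 htq1) ρ qK :=
  fun h => not_pinnedRegions_settingPrVolSharp_of_dvd_discr_of_five_le X M archPk archSub Ψ act Mmod region frobAdm frobLogvol frobΨ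
          frobMmod unitImage ballImage thetaDiv n lat sig split qData t tq ρ qK htq0 htq1 p hp hp5 hpd h.1

end Summit.ABC.IUTFork.Joshi

end
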